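import Summits.SmoothPoincare4.SmoothPoincare4.Theorems.DottedCircleRasmussenDcrGapHelperHandlebodyChartModelHandlesHoles
import Summits.SmoothPoincare4.SmoothPoincare4.Theorems.DottedCircleRasmussenDcrGapHelperHandlebodyChartModelHandlesPlanarTube

/-!
# Helper `helper_handlebodyChart_modelHandles` (M3: handle structure of the model dotted handlebody `D_k`)
# of line `mk_friends` for crux `DcrGap` — handle charts, part 8: the regime of a parameter of one chart
(item stmt-SmoothPoincare4-16128, route route-SmoothPoincare4-DottedCircleRasmussen)

Towards the registered stub `helper_handlebodyChart_modelHandles_data_part1`.  A handle chart `h` of hole `j` is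
given (without definitions, by defining equations) by the profiles `R`, `S` of `…ModelHandlesProfiles.lean` at
`V = |v_j|` (`v_j = c_j - z₀`, `z₀ = -20k i`), the width `b(p₁) = (793 + 95 p₁)/500`, the planar components
`r = R(p₀) + b(p₁) sin(π S(p₀))`, `m = -b(p₁) cos(π S(p₀))`, the scale `N = 110(k + 1)` and the polar formula
`z(h p) = z₀ + r s (v_j/|v_j|) e(m)` (`s = √(1 - (p₂² + p₃²)/N²)`) on the parameter box
`W = {|p₀| < 1.01, |p₁| < 1.01, p₂² + p₃² < 6/5}`.  This file computes, for a parameter `p ∈ W`: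

* `ModelHandles.box_props`: `W` is open and contains the closed tube `T`;
* `ModelHandles.chart_regime`: the values of `r`, `m`, `b`, `s` (positivity, `r(1 - s) ≤ 1/500`, the leg and bend
  regimes);
* `ModelHandles.chart_point`: the planar point `z(h p)` relative to its hole: `z - c_j = v_j (ρ - 1 + i μ)` with
  `ρ = r s/σ ∈ (0, 11/10]`, `|μ| |v_j| ≤ 1.78 ρ`, its distance `≥ 27/20` from `c_j`, and the geometric regime data.

Registered summary `helper_handlebodyChart_modelHandles_chartRegime`.  No definitions, no named facts,
no `sorry`.  References: R. Kirby, *The Topology of 4-Manifolds*, LNM 1374 (1989), Ch. I §2 [Kirby1989].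
-/

-- the prescribed namespace `Summit.<P>.<Sub>.…` duplicates `SmoothPoincare4` (P = Sub)
set_option linter.dupNamespace false
set_option linter.style.longLine false
noncomputable section

open scoped Manifold ContDiff Topology ComplexConjugate
open Function Set Metric Filter
open Literature.Topology.FourManifolds Literature.Topology.FourManifolds.MMSW
open Literature.AlgebraicTopology.Homotopy.HopfFibration

namespace Summit.SmoothPoincare4.SmoothPoincare4.Theorems.DcrGap.MkFriends

namespace ModelHandles

/-! ## The parameter box -/

/-- **The parameter box `W = {|p₀| < 1.01, |p₁| < 1.01, p₂² + p₃² < 6/5}` is open and contains the closed tube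
`T = {|p₀| ≤ 1, p₁² + p₂² + p₃² ≤ 1}`.** [folklore] -/
theorem box_props {W : Set (EuclideanSpace ℝ (Fin 4))}
    (hWdef : W = {p : EuclideanSpace ℝ (Fin 4) | |p 0| < 101 / 100 ∧ |p 1| < 101 / 100 ∧ (p 2) ^ 2 + (p 3) ^ 2 < 6 / 5}) :
    IsOpen W ∧ {p : EuclideanSpace ℝ (Fin 4) | |p 0| ≤ 1 ∧ (p 1) ^ 2 + (p 2) ^ 2 + (p 3) ^ 2 ≤ 1} ⊆ W := by
  subst hWdef
  constructor
  · simp only [Set.setOf_and]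
    refine (isOpen_lt (by fun_prop) continuous_const).inter
      ((isOpen_lt (by fun_prop) continuous_const).inter (isOpen_lt (by fun_prop) continuous_const))
  · rintro p ⟨h0, h1⟩
    have h2 := sq_nonneg (p 2)
    have h3 := sq_nonneg (p 3)
    refine ⟨by linarith, ?_, by nlinarith [sq_nonneg (p 1)]⟩
    have : (p 1) ^ 2 ≤ 1 := by linarith
    have : |p 1| ≤ 1 := abs_le.2 ⟨by nlinarith, by nlinarith⟩
    linarith

/-! ## The regime of a parameter -/

/-- **Values of the planar components on the box**: for `p ∈ W`, with `t = p₀`, `b = b(p₁) ∈ (1.39, 1.78)`,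
`s = √(1 - (p₂² + p₃²)/N²) ∈ (0, 1]`: `r > 0`, `r ≤ V + b`, `|m| ≤ b`, `r(1 - s) ≤ 1/500`, `p₂² + p₃² < N²`,
`r = a(2 - |t|)` for `|t| ≥ 1/2`, `r ≥ 3a/2` for `|t| ≤ 1/2`, and either the leg regime (`|t| ≥ 1/5`, `m² = b²`,
`r ≤ V`, `m < 0 ↔ t < 0`) or the bend regime (`|t| < 1/5`, `m² = b² c²`, `s'² + c² = 1`, `s' ≥ 0`,
`V - 1/250 + b s' ≤ r ≤ V + b s'`, `m = 0 → r ≥ V + b - 1/250`). [folklore] -/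
theorem chart_regime {k : ℕ} {j : Fin k} {R S b : ℝ → ℝ} {fr fm : ℝ → ℝ → ℝ} {v : ℂ} {N : ℝ}
    {W : Set (EuclideanSpace ℝ (Fin 4))}
    (hv : v = holeCentre k j - Complex.mk 0 (-(20 * (k : ℝ))))
    (hReven : ∀ t, R (-t) = R t) (hRout : ∀ t, 1 / 2 ≤ |t| → R t = 2 / 15 * (2 - |t|))
    (hRbend : ∀ t, |t| ≤ 1 / 5 → ‖v‖ - 1 / 250 ≤ R t ∧ R t ≤ ‖v‖)
    (hRbounds : ∀ t, -2 ≤ t → t ≤ 0 → 2 / 15 * (2 + t) ≤ R t ∧ R t ≤ ‖v‖) (hRmono : StrictMonoOn R (Icc (-2) 0))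
    (hS0 : ∀ t, t ≤ -1 / 5 → S t = 0) (hS1 : ∀ t, 1 / 5 ≤ t → S t = 1) (hS01 : ∀ t, 0 ≤ S t ∧ S t ≤ 1)
    (hb : b = fun p => (793 + 95 * p) / 500) (hN : N = 110 * ((k : ℝ) + 1))
    (hfr : fr = fun t p => R t + b p * Real.sin (Real.pi * S t)) (hfm : fm = fun t p => -(b p) * Real.cos (Real.pi * S t))
    (hWdef : W = {p : EuclideanSpace ℝ (Fin 4) | |p 0| < 101 / 100 ∧ |p 1| < 101 / 100 ∧ (p 2) ^ 2 + (p 3) ^ 2 < 6 / 5})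
    {p : EuclideanSpace ℝ (Fin 4)} (hp : p ∈ W) :
    139 / 100 < b (p 1) ∧ b (p 1) < 178 / 100 ∧ 0 < fr (p 0) (p 1) ∧ fr (p 0) (p 1) ≤ ‖v‖ + b (p 1) ∧
    |fm (p 0) (p 1)| ≤ b (p 1) ∧ (p 2) ^ 2 + (p 3) ^ 2 < N ^ 2 ∧
    0 < Real.sqrt (1 - ((p 2) ^ 2 + (p 3) ^ 2) / N ^ 2) ∧ Real.sqrt (1 - ((p 2) ^ 2 + (p 3) ^ 2) / N ^ 2) ≤ 1 ∧
    fr (p 0) (p 1) * (1 - Real.sqrt (1 - ((p 2) ^ 2 + (p 3) ^ 2) / N ^ 2)) ≤ 1 / 500 ∧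
    (1 / 2 ≤ |p 0| → fr (p 0) (p 1) = 2 / 15 * (2 - |p 0|)) ∧ (|p 0| ≤ 1 / 2 → 1 / 5 ≤ fr (p 0) (p 1)) ∧
    ((1 / 5 ≤ |p 0| ∧ fm (p 0) (p 1) ^ 2 = b (p 1) ^ 2 ∧ fr (p 0) (p 1) ≤ ‖v‖ ∧ (fm (p 0) (p 1) < 0 ↔ p 0 < 0)) ∨
      (|p 0| < 1 / 5 ∧ ∃ s c : ℝ, fm (p 0) (p 1) ^ 2 = b (p 1) ^ 2 * c ^ 2 ∧ s ^ 2 + c ^ 2 = 1 ∧ 0 ≤ s ∧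
        ‖v‖ - 1 / 250 + b (p 1) * s ≤ fr (p 0) (p 1) ∧ fr (p 0) (p 1) ≤ ‖v‖ + b (p 1) * s ∧
        (fm (p 0) (p 1) = 0 → ‖v‖ + b (p 1) - 1 / 250 ≤ fr (p 0) (p 1)))) := by
  obtain ⟨-, -, hk, -, -, h20, h416, -, hVpos⟩ := holeDir_props j hv
  subst hWdef hfr hfm hb
  obtain ⟨ht, hp1, hp23⟩ := hp
  obtain ⟨hb1, hb2, hsin, hsc, hrpos, hRle, hrle, hRlo, hRV, hout, hmid, hreg⟩ :=
    tube_regimes (V := ‖v‖) hReven hRout hRbend hRbounds hRmono hS0 hS1 hS01 ht hp1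
  simp only
  have hbpos : 0 < (793 + 95 * p 1) / 500 := by linarith
  -- the scale factor
  have hN110 : (110 : ℝ) ≤ N := by rw [hN]; linarith
  have hNpos : 0 < N := by linarith
  have hN2 : (12100 : ℝ) ≤ N ^ 2 := by
    rw [sq]; exact le_trans (by norm_num) (mul_le_mul hN110 hN110 (by norm_num) hNpos.le)
  have hρN' : (p 2) ^ 2 + (p 3) ^ 2 < N ^ 2 := by linarith
  have hρN : ((p 2) ^ 2 + (p 3) ^ 2) / N ^ 2 < 1 := by rw [div_lt_one (by positivity)]; exact hρN'
  have hρ0 : 0 ≤ ((p 2) ^ 2 + (p 3) ^ 2) / N ^ 2 := div_nonneg (by positivity) (sq_nonneg N)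
  have hsw0 : 0 < Real.sqrt (1 - ((p 2) ^ 2 + (p 3) ^ 2) / N ^ 2) := Real.sqrt_pos.2 (by linarith)
  have hsw1 : Real.sqrt (1 - ((p 2) ^ 2 + (p 3) ^ 2) / N ^ 2) ≤ 1 := by rw [Real.sqrt_le_one]; linarith
  -- `1 - s ≤ (6/5)/N²` and `r ≤ V + 1.78 ≤ 22 (k + 1)`, `N = 110 (k+1)`
  have hdef : 1 - Real.sqrt (1 - ((p 2) ^ 2 + (p 3) ^ 2) / N ^ 2) ≤ (6 / 5) / N ^ 2 := by
    have hx : 0 ≤ 1 - ((p 2) ^ 2 + (p 3) ^ 2) / N ^ 2 := by linarith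
    have hx1 : 1 - ((p 2) ^ 2 + (p 3) ^ 2) / N ^ 2 ≤ 1 := by linarith
    have h1 : 1 - ((p 2) ^ 2 + (p 3) ^ 2) / N ^ 2 ≤ Real.sqrt (1 - ((p 2) ^ 2 + (p 3) ^ 2) / N ^ 2) := by
      have hsq : (1 - ((p 2) ^ 2 + (p 3) ^ 2) / N ^ 2) ^ 2 ≤ 1 - ((p 2) ^ 2 + (p 3) ^ 2) / N ^ 2 := by
        rw [sq]; exact mul_le_of_le_one_right hx hx1
      have := Real.sqrt_le_sqrt hsq
      rwa [Real.sqrt_sq hx] at this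
    have h2 : ((p 2) ^ 2 + (p 3) ^ 2) / N ^ 2 ≤ (6 / 5) / N ^ 2 := div_le_div_of_nonneg_right hp23.le (sq_nonneg N)
    linarith
  have hV204 : ‖v‖ ≤ 204 / 10 * k := by
    refine (pow_le_pow_iff_left₀ hVpos.le (by positivity) two_ne_zero).1 ?_
    have := sq_nonneg (k : ℝ)
    rw [mul_pow]; linarith
  have hsmall : (R (p 0) + (793 + 95 * p 1) / 500 * Real.sin (Real.pi * S (p 0))) *
      (1 - Real.sqrt (1 - ((p 2) ^ 2 + (p 3) ^ 2) / N ^ 2)) ≤ 1 / 500 := by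
    have hr22 : R (p 0) + (793 + 95 * p 1) / 500 * Real.sin (Real.pi * S (p 0)) ≤ 22 * ((k : ℝ) + 1) := by linarith
    have hkey : 22 * ((k : ℝ) + 1) * ((6 / 5) / N ^ 2) ≤ 1 / 500 := by
      rw [hN, mul_div_assoc', div_le_iff₀ (by positivity)]
      have hk1 : (2 : ℝ) ≤ k + 1 := by linarith
      have := mul_le_mul_of_nonneg_left hk1 (by positivity : (0 : ℝ) ≤ 12100 * ((k : ℝ) + 1))
      nlinarith
    calc _ ≤ 22 * ((k : ℝ) + 1) * ((6 / 5) / N ^ 2) := mul_le_mul hr22 hdef (by linarith) (by positivity)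
      _ ≤ 1 / 500 := hkey
  refine ⟨hb1, hb2, hrpos, hrle, ?_, hρN', hsw0, hsw1, hsmall, hout, fun hh => (hmid hh).trans hRle, ?_⟩
  · rw [abs_mul, abs_neg, abs_of_pos hbpos]
    exact mul_le_of_le_one_right hbpos.le (Real.abs_cos_le_one _)
  rcases hreg with ⟨h5, hs0, hc1⟩ | ⟨h5, hRlo', hRhi'⟩
  · left
    refine ⟨h5, ?_, ?_, ?_⟩
    · rcases hc1 with hc | hc <;> rw [hc] <;> ring
    · rw [hs0, mul_zero, add_zero]; exact hRV
    · -- sign of `m` on the legs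
      rcases le_or_gt 0 (p 0) with h0 | h0
      · rw [abs_of_nonneg h0] at h5
        rw [hS1 _ h5, mul_one, Real.cos_pi]
        constructor
        · intro h; linarith
        · intro h; linarith
      · rw [abs_of_neg h0] at h5
        rw [hS0 _ (by linarith), mul_zero, Real.cos_zero]
        exact ⟨fun _ => h0, fun _ => by linarith⟩
  · right
    refine ⟨h5, Real.sin (Real.pi * S (p 0)), Real.cos (Real.pi * S (p 0)), by ring, hsc, hsin, by linarith,
      by linarith, fun hm0 => ?_⟩
    have hcos : Real.cos (Real.pi * S (p 0)) = 0 := by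
      rcases mul_eq_zero.1 hm0 with h | h
      · linarith
      · exact h
    have hsin1 : Real.sin (Real.pi * S (p 0)) = 1 := by
      have : Real.sin (Real.pi * S (p 0)) ^ 2 = 1 := by rw [hcos] at hsc; linarith
      exact (pow_eq_one_iff_of_nonneg hsin two_ne_zero).1 this
    rw [hsin1]; linarith

/-! ## The planar point of the chart relative to its hole -/

/-- **The planar point `z(h p)` of a parameter `p ∈ W`**: with `r' = r s`, `σ = √(V² + m²)`, `ρ = r'/σ`,
`μ = r' m/(V σ)` (`V = |v_j|`): `0 < ρ ≤ 11/10`, `|μ| V ≤ 1.78 ρ`, `r - 1/500 ≤ r' ≤ r`,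
`z - c_j = v_j (ρ - 1 + i μ)`, `|z - c_j|² = (r' V/σ - V)² + (r' m/σ)² ≥ (27/20)²`,
`Re((z - c_j)\bar v_j) = V² (ρ - 1)`, `Im((z - c_j)\bar v_j) = V r' m/σ`, `z = (1 - ρ) z₀ + ρ c_j + i μ v_j`, and the
geometric regime (legs: `m² = b²`, `r' ≤ V`, sign of `m` = sign of `p₀`; bend: `m² = b² c²`, `s'² + c² = 1`,
`s' ≥ 0`, `V + b s' - 1/100 ≤ r' ≤ V + b s'`, `m = 0 → r' > V`). [folklore] -/
theorem chart_point {k : ℕ} {j : Fin k} {R S b : ℝ → ℝ} {fr fm : ℝ → ℝ → ℝ} {v : ℂ} {N : ℝ} {e : ℝ → ℂ}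
    {h : EuclideanSpace ℝ (Fin 4) → EuclideanSpace ℝ (Fin 4)} {W : Set (EuclideanSpace ℝ (Fin 4))}
    (hv : v = holeCentre k j - Complex.mk 0 (-(20 * (k : ℝ))))
    (hReven : ∀ t, R (-t) = R t) (hRout : ∀ t, 1 / 2 ≤ |t| → R t = 2 / 15 * (2 - |t|))
    (hRbend : ∀ t, |t| ≤ 1 / 5 → ‖v‖ - 1 / 250 ≤ R t ∧ R t ≤ ‖v‖)
    (hRbounds : ∀ t, -2 ≤ t → t ≤ 0 → 2 / 15 * (2 + t) ≤ R t ∧ R t ≤ ‖v‖) (hRmono : StrictMonoOn R (Icc (-2) 0))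
    (hS0 : ∀ t, t ≤ -1 / 5 → S t = 0) (hS1 : ∀ t, 1 / 5 ≤ t → S t = 1) (hS01 : ∀ t, 0 ≤ S t ∧ S t ≤ 1)
    (hb : b = fun p => (793 + 95 * p) / 500) (hN : N = 110 * ((k : ℝ) + 1))
    (he : ∀ m, e m = (((‖v‖ : ℝ) : ℂ) + (m : ℂ) * Complex.I) * (((Real.sqrt (‖v‖ ^ 2 + m ^ 2))⁻¹ : ℝ) : ℂ))
    (hfr : fr = fun t p => R t + b p * Real.sin (Real.pi * S t)) (hfm : fm = fun t p => -(b p) * Real.cos (Real.pi * S t))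
    (hz : ∀ p, zC (h p) = Complex.mk 0 (-(20 * (k : ℝ))) +
      ((fr (p 0) (p 1) * Real.sqrt (1 - ((p 2) ^ 2 + (p 3) ^ 2) / N ^ 2) : ℝ) : ℂ) * (v / ((‖v‖ : ℝ) : ℂ)) * e (fm (p 0) (p 1)))
    (hWdef : W = {p : EuclideanSpace ℝ (Fin 4) | |p 0| < 101 / 100 ∧ |p 1| < 101 / 100 ∧ (p 2) ^ 2 + (p 3) ^ 2 < 6 / 5})
    {p : EuclideanSpace ℝ (Fin 4)} (hp : p ∈ W) :
    ∃ r' m σ ρ μ : ℝ, m = fm (p 0) (p 1) ∧ σ = Real.sqrt (‖v‖ ^ 2 + m ^ 2) ∧ σ ^ 2 = ‖v‖ ^ 2 + m ^ 2 ∧ 0 < σ ∧ ‖v‖ ≤ σ ∧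
      σ ≤ ‖v‖ + m ^ 2 / (2 * ‖v‖) ∧ r' = fr (p 0) (p 1) * Real.sqrt (1 - ((p 2) ^ 2 + (p 3) ^ 2) / N ^ 2) ∧ 0 < r' ∧
      fr (p 0) (p 1) - 1 / 500 ≤ r' ∧ r' ≤ fr (p 0) (p 1) ∧ ρ = r' / σ ∧ 0 < ρ ∧ ρ ≤ 11 / 10 ∧
      μ = r' * m / (‖v‖ * σ) ∧ |μ| * ‖v‖ ≤ ρ * (178 / 100) ∧ |m| ≤ 178 / 100 ∧
      zC (h p) - holeCentre k j = v * (((ρ - 1 : ℝ) : ℂ) + (μ : ℂ) * Complex.I) ∧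
      ‖zC (h p) - holeCentre k j‖ ^ 2 = (r' * ‖v‖ / σ - ‖v‖) ^ 2 + (r' * m / σ) ^ 2 ∧
      ((zC (h p) - holeCentre k j) * conj v).re = ‖v‖ ^ 2 * (ρ - 1) ∧
      ((zC (h p) - holeCentre k j) * conj v).im = ‖v‖ * (r' * m / σ) ∧
      zC (h p) = ((1 - ρ : ℝ) : ℂ) * Complex.mk 0 (-(20 * (k : ℝ))) + (ρ : ℂ) * (Complex.mk 0 (-(20 * (k : ℝ))) + v) +
        (μ : ℂ) * v * Complex.I ∧
      (27 / 20 : ℝ) ^ 2 ≤ ‖zC (h p) - holeCentre k j‖ ^ 2 ∧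
      ((m ^ 2 = b (p 1) ^ 2 ∧ r' ≤ ‖v‖ ∧ 1 / 5 ≤ |p 0| ∧ (m < 0 ↔ p 0 < 0)) ∨
        (|p 0| < 1 / 5 ∧ ∃ s c : ℝ, m ^ 2 = b (p 1) ^ 2 * c ^ 2 ∧ s ^ 2 + c ^ 2 = 1 ∧ 0 ≤ s ∧
          ‖v‖ + b (p 1) * s - 1 / 100 ≤ r' ∧ r' ≤ ‖v‖ + b (p 1) * s ∧ (m = 0 → ‖v‖ < r'))) := by
  obtain ⟨-, -, hk, -, -, h20, h416, hv0, hVpos⟩ := holeDir_props j hv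
  obtain ⟨hb1, hb2, hrpos, hrle, hmle, hWN, hsw0, hsw1, hsmall, -, -, hreg⟩ :=
    chart_regime hv hReven hRout hRbend hRbounds hRmono hS0 hS1 hS01 hb hN hfr hfm hWdef hp
  set r := fr (p 0) (p 1) with hr
  set m := fm (p 0) (p 1) with hm
  set sw := Real.sqrt (1 - ((p 2) ^ 2 + (p 3) ^ 2) / N ^ 2) with hsw
  set r' := r * sw with hr'
  obtain ⟨hσ2, hσpos, hVσ, hσV⟩ := sigma_props (m := m) hVpos
  set σ := Real.sqrt (‖v‖ ^ 2 + m ^ 2) with hσ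
  have hr'pos : 0 < r' := mul_pos hrpos hsw0
  have hr'le : r' ≤ r := by rw [hr']; exact mul_le_of_le_one_right hrpos.le hsw1
  have hr'ge : r - 1 / 500 ≤ r' := by
    have : r * sw = r - r * (1 - sw) := by ring
    rw [hr', this]; linarith
  set ρ := r' / σ with hρ
  have hρpos : 0 < ρ := div_pos hr'pos hσpos
  have hρle : ρ ≤ 11 / 10 := by
    rw [hρ, div_le_iff₀ hσpos]; linarith
  set μ := r' * m / (‖v‖ * σ) with hμ
  have hm178 : |m| ≤ 178 / 100 := hmle.trans hb2.le
  have hμV : |μ| * ‖v‖ ≤ ρ * (178 / 100) := by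
    have e1 : |μ| * ‖v‖ = ρ * |m| := by
      rw [hμ, hρ, abs_div, abs_mul, abs_of_pos hr'pos, abs_of_pos (mul_pos hVpos hσpos)]
      field_simp
    rw [e1]; exact mul_le_mul_of_nonneg_left hm178 hρpos.le
  -- the tube point identities
  have hz' : zC (h p) = Complex.mk 0 (-(20 * (k : ℝ))) + ((r' : ℝ) : ℂ) * (v / ((‖v‖ : ℝ) : ℂ)) *
      ((((‖v‖ : ℝ) : ℂ) + (m : ℂ) * Complex.I) * (((Real.sqrt (‖v‖ ^ 2 + m ^ 2))⁻¹ : ℝ) : ℂ)) := by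
    rw [hz p, he]
  obtain ⟨e1, e2, e3, e4, e5⟩ := tubePoint_eqs hv0 hz'
  have hc : Complex.mk 0 (-(20 * (k : ℝ))) + v = holeCentre k j := by rw [hv]; ring
  rw [hc] at e1 e2 e3 e4
  rw [← hσ] at e1 e2 e3 e4 e5
  have hμ' : r' * m / (‖v‖ * σ) = μ := rfl
  have hρ' : r' / σ = ρ := rfl
  rw [hμ', hρ'] at e1 e5
  rw [hρ'] at e3
  -- the geometric regime and the distance to the hole
  have hgeo : (m ^ 2 = b (p 1) ^ 2 ∧ r' ≤ ‖v‖ ∧ 1 / 5 ≤ |p 0| ∧ (m < 0 ↔ p 0 < 0)) ∨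
      (|p 0| < 1 / 5 ∧ ∃ s c : ℝ, m ^ 2 = b (p 1) ^ 2 * c ^ 2 ∧ s ^ 2 + c ^ 2 = 1 ∧ 0 ≤ s ∧
        ‖v‖ + b (p 1) * s - 1 / 100 ≤ r' ∧ r' ≤ ‖v‖ + b (p 1) * s ∧ (m = 0 → ‖v‖ < r')) := by
    rcases hreg with ⟨h5, hm2, hrV, hsign⟩ | ⟨h5, s, c, hm2, hsc, hs, hlo, hhi, hm0⟩
    · exact Or.inl ⟨hm2, hr'le.trans hrV, h5, hsign⟩
    · refine Or.inr ⟨h5, s, c, hm2, hsc, hs, by linarith, by linarith, fun h0 => ?_⟩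
      have := hm0 h0; linarith
  have hdist : (27 / 20 : ℝ) ^ 2 ≤ ‖zC (h p) - holeCentre k j‖ ^ 2 := by
    rw [e2]
    refine holeDist_ge h20 hσ2 hσpos hVσ hb1.le hb2.le ?_
    rcases hgeo with ⟨hm2, -, -, -⟩ | ⟨-, s, c, hm2, hsc, hs, hlo, -, -⟩
    · exact Or.inl hm2
    · exact Or.inr ⟨s, c, hm2, hsc, hs, hlo⟩
  exact ⟨r', m, σ, ρ, μ, rfl, rfl, hσ2, hσpos, hVσ, hσV, rfl, hr'pos, hr'ge, hr'le, rfl, hρpos, hρle, rfl, hμV, hm178,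
    e1, e2, e3, e4, e5, hdist, hgeo⟩

end ModelHandles

/-- **Registered piece `helper_handlebodyChart_modelHandles_chartRegime` of the data stub, part 1 (the regime of a
parameter of one chart)**: the parameter box `W = {|p₀| < 1.01, |p₁| < 1.01, p₂² + p₃² < 6/5}` is open and contains
the closed tube `T` (`ModelHandles.box_props`); the per-parameter packages are `ModelHandles.chart_regime` and
`ModelHandles.chart_point`. [folklore] -/
theorem helper_handlebodyChart_modelHandles_chartRegime : ∀ (W : Set (EuclideanSpace ℝ (Fin 4))), W = {p : EuclideanSpace ℝ (Fin 4) | |p 0| < 101 / 100 ∧ |p 1| < 101 / 100 ∧ (p 2) ^ 2 + (p 3) ^ 2 < 6 / 5} → IsOpen W ∧ {p : EuclideanSpace ℝ (Fin 4) | |p 0| ≤ 1 ∧ (p 1) ^ 2 + (p 2) ^ 2 + (p 3) ^ 2 ≤ 1} ⊆ W :=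
  fun _ hW => ModelHandles.box_props hW

end Summit.SmoothPoincare4.SmoothPoincare4.Theorems.DcrGap.MkFriends

end
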